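import Mathlib
import Summits.AnomalousDissipation.AnomalousDissipation.Theorems.DyadicWallCascadeViscousContinuationStubNoFastBlowDownMomentumTools
import Summits.AnomalousDissipation.AnomalousDissipation.Theorems.DyadicWallCascadeViscousContinuationStubNoFastBlowDownWeylTools
import HarnessLib

/-!
# Pairing and transfer tools for the rate obstruction `NoFastBlowDown` (crux `ViscousContinuation`)

Crux `Summit.AnomalousDissipation.AnomalousDissipation.Theses.DyadicWallCascade.ViscousContinuation`
(stmt-AnomalousDissipation-17917, line SketchIdeator4, lead c1).  Tools for the assembly file
`Theorems/ViscousContinuation/Negative/NoFastBlowDown.lean` of the rate obstruction (the band blow-down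
error of a viscous wall profile is never `o(2⁻ᵐ)`):

* `noFastBlowDown_laplacian_pairing_eq_zero` — TESTED MOMENTUM ⇒ THE LAPLACIAN PAIRING OF THE LIMIT
  VANISHES: for a smooth bounded-velocity solution `(W, P)` of the clause-form stationary
  Navier–Stokes system on `ℝ³`, continuous `V', Q'`, `φ ∈ C_c^∞`, if for every `ε > 0` there are
  arbitrarily large `m` with `‖W (2ᵐ·) - V'‖, |P (2ᵐ·) - Q'| ≤ ε 2⁻ᵐ` on `tsupport φ`, then
  `∫ Δφ · V'ᵢ = 0` (identity `T₁(λ) + T₂(λ) = -λ⁻¹ L(λ)` of `…MomentumTools` at `λ = 2ᵐ`; first the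
  weak Euler identity `T₁(V') + T₂(Q') = 0` by `m → ∞`, then `|∫ Δφ · V'ᵢ| ≤ ε K_φ`);
* `noFastBlowDown_harmonic_lower_band`, `noFastBlowDown_harmonic_interface` — harmonicity
  (`Σᵢ ∂ᵢ∂ᵢ U = 0`) transfers from the open band `1 < X₂ < 2` down one octave along `U = U ∘ (2 •)`
  (chain rule) and to the interface plane `X₂ = 1` (continuity);
* two elementary real-number lemmas.

The file ends with the registered tools stub `stub_noFastBlowDownPairingTools`.
-/

open MeasureTheory Set Filter Topology Function
open Literature.Analysis.FluidPDE
open scoped Laplacian RealInnerProductSpace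

set_option linter.dupNamespace false

noncomputable section

namespace Summit.AnomalousDissipation.AnomalousDissipation.Theorems

/-! ## Two elementary lemmas -/

/-- If `|a| ≤ ε K` for every `ε > 0` (with `K ≥ 0` fixed), then `a = 0`. [folklore] -/
theorem noFastBlowDown_eq_zero_of_abs_le {a K : ℝ} (hK : 0 ≤ K)
    (h : ∀ ε : ℝ, 0 < ε → |a| ≤ ε * K) : a = 0 := by
  by_contra ha
  have hpos : 0 < |a| := abs_pos.2 ha
  have h1 := h (|a| / (2 * (K + 1))) (by positivity)
  have hK1 : K / (K + 1) ≤ 1 := (div_le_one (by linarith)).2 (by linarith)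
  have : |a| / (2 * (K + 1)) * K = |a| / 2 * (K / (K + 1)) := by
    field_simp
  rw [this] at h1
  nlinarith [mul_le_mul_of_nonneg_left hK1 (by positivity : 0 ≤ |a| / 2)]

/-- Powers of two eventually dominate: for every real `c` there is `M` with `c ≤ 2 ^ M`, and then
`c (2 ^ m)⁻¹ ≤ 1` for all `m ≥ M` when `0 ≤ c`. [folklore] -/
theorem noFastBlowDown_exists_pow_ge (c : ℝ) : ∃ M : ℕ, ∀ m : ℕ, M ≤ m → c * ((2 : ℝ) ^ m)⁻¹ ≤ 1 := by
  obtain ⟨M, hM⟩ := pow_unbounded_of_one_lt c (one_lt_two : (1 : ℝ) < 2)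
  refine ⟨M, fun m hm => ?_⟩
  have h2 : (0 : ℝ) < 2 ^ m := by positivity
  have hle : c ≤ (2 : ℝ) ^ m := hM.le.trans (pow_le_pow_right₀ one_le_two hm)
  rw [mul_inv_le_iff₀ h2, one_mul]
  exact hle

/-! ## The Laplacian pairing of the limit vanishes -/

/-- **Tested momentum ⇒ the Laplacian pairing of the limit vanishes.**  Let `(W, P)` be a smooth
bounded-velocity solution of the clause-form stationary Navier–Stokes system on `ℝ³`, `V', Q'`
continuous, `φ ∈ C_c^∞`, and suppose that for every `ε > 0` there are arbitrarily large `m` with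
`‖W (2ᵐY) - V' Y‖ ≤ ε 2⁻ᵐ` and `|P (2ᵐY) - Q' Y| ≤ ε 2⁻ᵐ` on `tsupport φ`.  Then
`∫ Δφ · V'ᵢ = 0`.  (The tested momentum identity `T₁(λ) + T₂(λ) = -λ⁻¹L(λ)` of the rescaled
solution, `λ = 2ᵐ`; first `T₁(V') + T₂(Q') = 0` by letting `m → ∞`, then
`|∫ Δφ · V'ᵢ| ≤ |L(λ) - ∫ Δφ · V'ᵢ| + λ |T₁(λ) - T₁(V') + T₂(λ) - T₂(Q')| ≤ ε K_φ`.) [folklore] -/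
theorem noFastBlowDown_laplacian_pairing_eq_zero
    (W V' : EuclideanSpace ℝ (Fin 3) → EuclideanSpace ℝ (Fin 3)) (P Q' : EuclideanSpace ℝ (Fin 3) → ℝ)
    (C C' : ℝ) (φ : EuclideanSpace ℝ (Fin 3) → ℝ) (i : Fin 3)
    (hWs : ContDiff ℝ ((⊤ : ℕ∞) : WithTop ℕ∞) W) (hPs : ContDiff ℝ ((⊤ : ℕ∞) : WithTop ℕ∞) P)
    (hWdiv : ∀ X : EuclideanSpace ℝ (Fin 3),
      ∑ i : Fin 3, (fderiv ℝ W X (EuclideanSpace.single i (1 : ℝ))) i = 0)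
    (hNS : ∀ X : EuclideanSpace ℝ (Fin 3), (fderiv ℝ W X) (W X) + gradient P X =
      ∑ i : Fin 3, fderiv ℝ (fun Y => fderiv ℝ W Y (EuclideanSpace.single i (1 : ℝ))) X
        (EuclideanSpace.single i (1 : ℝ)))
    (hWb : ∀ X, ‖W X‖ ≤ C') (hV'c : Continuous V') (hQ'c : Continuous Q')
    (hφ : ContDiff ℝ ((⊤ : ℕ∞) : WithTop ℕ∞) φ) (hφc : HasCompactSupport φ)
    (hV'b : ∀ Y ∈ tsupport φ, ‖V' Y‖ ≤ C)
    (hnear : ∀ ε : ℝ, 0 < ε → ∀ M : ℕ, ∃ m : ℕ, M ≤ m ∧ ∀ Y ∈ tsupport φ,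
      ‖W ((2 : ℝ) ^ m • Y) - V' Y‖ ≤ ε * ((2 : ℝ) ^ m)⁻¹ ∧
        |P ((2 : ℝ) ^ m • Y) - Q' Y| ≤ ε * ((2 : ℝ) ^ m)⁻¹) :
    ∫ Y, (Δ φ) Y * (V' Y) i = 0 := by
  set e : Fin 3 → EuclideanSpace ℝ (Fin 3) := fun i => EuclideanSpace.single i (1 : ℝ) with he
  have hWc : Continuous W := hWs.continuous
  have hPc : Continuous P := hPs.continuous
  have hφ1 : ContDiff ℝ 1 φ := contDiff_infty.1 hφ 1
  have hφ2 : ContDiff ℝ 2 φ := contDiff_infty.1 hφ 2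
  -- nonnegative constants
  set Cp : ℝ := max C 0 with hCp
  have hCp0 : 0 ≤ Cp := le_max_right _ _
  have hV'b' : ∀ Y ∈ tsupport φ, ‖V' Y‖ ≤ Cp := fun Y hY => (hV'b Y hY).trans (le_max_left _ _)
  have hC'0 : 0 ≤ C' := (norm_nonneg _).trans (hWb 0)
  set K1 : ℝ := ∫ Y, ‖fderiv ℝ φ Y‖ with hK1
  set K2 : ℝ := ∫ Y, |(Δ φ) Y| with hK2
  have hK10 : 0 ≤ K1 := integral_nonneg fun Y => norm_nonneg _
  have hK20 : 0 ≤ K2 := integral_nonneg fun Y => abs_nonneg _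
  -- the tested quantities
  set T1 : ℝ → ℝ := fun lam => ∫ Y, (W (lam • Y)) i * fderiv ℝ φ Y (W (lam • Y)) with hT1
  set T2 : ℝ → ℝ := fun lam => ∫ Y, P (lam • Y) * fderiv ℝ φ Y (e i) with hT2
  set L : ℝ → ℝ := fun lam => ∫ Y, (Δ φ) Y * (W (lam • Y)) i with hL
  set T1V : ℝ := ∫ Y, (V' Y) i * fderiv ℝ φ Y (V' Y) with hT1V
  set T2V : ℝ := ∫ Y, Q' Y * fderiv ℝ φ Y (e i) with hT2V
  set LV : ℝ := ∫ Y, (Δ φ) Y * (V' Y) i with hLV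
  -- the package of estimates at scale `2 ^ m`, error `ε 2⁻ᵐ`
  have pack : ∀ (ε : ℝ) (m : ℕ), 0 < ε →
      (∀ Y ∈ tsupport φ, ‖W ((2 : ℝ) ^ m • Y) - V' Y‖ ≤ ε * ((2 : ℝ) ^ m)⁻¹ ∧
        |P ((2 : ℝ) ^ m • Y) - Q' Y| ≤ ε * ((2 : ℝ) ^ m)⁻¹) →
      T1 ((2 : ℝ) ^ m) + T2 ((2 : ℝ) ^ m) = -(((2 : ℝ) ^ m)⁻¹ * L ((2 : ℝ) ^ m)) ∧
      |T1 ((2 : ℝ) ^ m) - T1V| ≤ ε * ((2 : ℝ) ^ m)⁻¹ * ((C' + Cp) * K1) ∧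
      |T2 ((2 : ℝ) ^ m) - T2V| ≤ ε * ((2 : ℝ) ^ m)⁻¹ * K1 ∧
      |L ((2 : ℝ) ^ m) - LV| ≤ ε * ((2 : ℝ) ^ m)⁻¹ * K2 ∧
      |L ((2 : ℝ) ^ m)| ≤ C' * K2 := by
    intro ε m hε hY
    have hlam : (0 : ℝ) < (2 : ℝ) ^ m := by positivity
    have hδ : 0 ≤ ε * ((2 : ℝ) ^ m)⁻¹ := by positivity
    exact ⟨noFastBlowDown_momentum_identity W P φ i hWs hPs hWdiv hNS hφ2 hφc _ hlam,
      noFastBlowDown_momentum_convective_diff W V' φ Cp C' _ _ i hWc hV'c hφ1 hφc hWb hV'b' hδ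
        (fun Y hY' => (hY Y hY').1),
      noFastBlowDown_momentum_pressure_diff P Q' φ _ _ i hPc hQ'c hφ1 hφc hδ
        (fun Y hY' => (hY Y hY').2),
      noFastBlowDown_momentum_laplacian_diff W V' φ _ _ i hWc hV'c hφ2 hφc hδ
        (fun Y hY' => (hY Y hY').1),
      noFastBlowDown_momentum_laplacian_bound W φ C' _ i hWc hφ2 hφc hWb⟩
  -- (a) the weak Euler identity of the limit: `T1V + T2V = 0`
  have hS : T1V + T2V = 0 := by
    refine noFastBlowDown_eq_zero_of_abs_le (K := (C' + Cp) * K1 + K1 + 1) (by positivity) ?_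
    intro ε hε
    obtain ⟨M, hM⟩ := noFastBlowDown_exists_pow_ge (C' * K2 / ε)
    obtain ⟨m, hMm, hY⟩ := hnear ε hε M
    obtain ⟨hid, h1, h2, -, h4⟩ := pack ε m hε hY
    have hlam : (0 : ℝ) < (2 : ℝ) ^ m := by positivity
    have hinv1 : ((2 : ℝ) ^ m)⁻¹ ≤ 1 := inv_le_one_of_one_le₀ (one_le_pow₀ one_le_two)
    have hεm : ε * ((2 : ℝ) ^ m)⁻¹ ≤ ε := by nlinarith
    -- `λ⁻¹ |L| ≤ ε`
    have hL' : ((2 : ℝ) ^ m)⁻¹ * |L ((2 : ℝ) ^ m)| ≤ ε := by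
      have h := hM m hMm
      calc ((2 : ℝ) ^ m)⁻¹ * |L ((2 : ℝ) ^ m)| ≤ ((2 : ℝ) ^ m)⁻¹ * (C' * K2) :=
            mul_le_mul_of_nonneg_left h4 (by positivity)
        _ = ε * (C' * K2 / ε * ((2 : ℝ) ^ m)⁻¹) := by field_simp
        _ ≤ ε * 1 := mul_le_mul_of_nonneg_left h hε.le
        _ = ε := mul_one ε
    have key : T1V + T2V = -(T1 ((2 : ℝ) ^ m) - T1V) - (T2 ((2 : ℝ) ^ m) - T2V) -
        ((2 : ℝ) ^ m)⁻¹ * L ((2 : ℝ) ^ m) := by linarith [hid]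
    calc |T1V + T2V| ≤ |T1 ((2 : ℝ) ^ m) - T1V| + |T2 ((2 : ℝ) ^ m) - T2V| +
          ((2 : ℝ) ^ m)⁻¹ * |L ((2 : ℝ) ^ m)| := by
            rw [key]
            refine (abs_sub _ _).trans (add_le_add ((abs_sub _ _).trans (add_le_add ?_ le_rfl)) ?_)
            · rw [abs_neg]
            · rw [abs_mul, abs_of_pos (inv_pos.2 hlam)]
      _ ≤ ε * ((2 : ℝ) ^ m)⁻¹ * ((C' + Cp) * K1) + ε * ((2 : ℝ) ^ m)⁻¹ * K1 + ε :=
            add_le_add (add_le_add h1 h2) hL'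
      _ ≤ ε * ((C' + Cp) * K1) + ε * K1 + ε :=
            add_le_add (add_le_add (mul_le_mul_of_nonneg_right hεm (by positivity))
              (mul_le_mul_of_nonneg_right hεm hK10)) le_rfl
      _ = ε * ((C' + Cp) * K1 + K1 + 1) := by ring
  -- (b) the Laplacian pairing vanishes
  refine noFastBlowDown_eq_zero_of_abs_le (K := K2 + ((C' + Cp) * K1 + K1)) (by positivity) ?_
  intro ε hε
  obtain ⟨m, -, hY⟩ := hnear ε hε 0
  obtain ⟨hid, h1, h2, h3, -⟩ := pack ε m hε hY
  have hlam : (0 : ℝ) < (2 : ℝ) ^ m := by positivity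
  -- `L = -λ (T1 + T2) = -λ ((T1 - T1V) + (T2 - T2V))`
  have hLid : L ((2 : ℝ) ^ m) =
      -((2 : ℝ) ^ m * ((T1 ((2 : ℝ) ^ m) - T1V) + (T2 ((2 : ℝ) ^ m) - T2V))) := by
    have h : (2 : ℝ) ^ m * (T1 ((2 : ℝ) ^ m) + T2 ((2 : ℝ) ^ m)) = -L ((2 : ℝ) ^ m) := by
      rw [hid, mul_neg, ← mul_assoc, mul_inv_cancel₀ hlam.ne', one_mul]
    linear_combination h - (2 : ℝ) ^ m * hS
  have hLbd : |L ((2 : ℝ) ^ m)| ≤ ε * ((C' + Cp) * K1 + K1) := by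
    rw [hLid, abs_neg, abs_mul, abs_of_pos hlam]
    calc (2 : ℝ) ^ m * |T1 ((2 : ℝ) ^ m) - T1V + (T2 ((2 : ℝ) ^ m) - T2V)|
        ≤ (2 : ℝ) ^ m * (ε * ((2 : ℝ) ^ m)⁻¹ * ((C' + Cp) * K1) + ε * ((2 : ℝ) ^ m)⁻¹ * K1) :=
          mul_le_mul_of_nonneg_left ((abs_add_le _ _).trans (add_le_add h1 h2)) hlam.le
      _ = ε * ((C' + Cp) * K1 + K1) := by field_simp
  have hinv1 : ((2 : ℝ) ^ m)⁻¹ ≤ 1 := inv_le_one_of_one_le₀ (one_le_pow₀ one_le_two)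
  have hεm : ε * ((2 : ℝ) ^ m)⁻¹ ≤ ε := by nlinarith
  calc |LV| = |(LV - L ((2 : ℝ) ^ m)) + L ((2 : ℝ) ^ m)| := by rw [sub_add_cancel]
    _ ≤ |LV - L ((2 : ℝ) ^ m)| + |L ((2 : ℝ) ^ m)| := abs_add_le _ _
    _ ≤ ε * ((2 : ℝ) ^ m)⁻¹ * K2 + ε * ((C' + Cp) * K1 + K1) := by
          refine add_le_add ?_ hLbd
          rw [abs_sub_comm]; exact h3
    _ ≤ ε * K2 + ε * ((C' + Cp) * K1 + K1) :=
          add_le_add (mul_le_mul_of_nonneg_right hεm hK20) le_rfl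
    _ = ε * (K2 + ((C' + Cp) * K1 + K1)) := by ring

/-! ## Harmonicity transfers down one octave and to the interface -/

/-- **Harmonicity on the lower band by dilation.**  If a smooth `U` satisfies `U Y = U (2 • Y)` on
the open band `1/2 < Y₂ < 1` and `Σᵢ ∂ᵢ∂ᵢ U = 0` on the open band `1 < X₂ < 2`, then
`Σᵢ ∂ᵢ∂ᵢ U = 0` on `1/2 < X₂ < 1` as well (chain rule: the pure second derivatives of
`U ∘ (2 •)` at `X` are `4` times those of `U` at `2X`). [folklore] -/
theorem noFastBlowDown_harmonic_lower_band
    (U : EuclideanSpace ℝ (Fin 3) → EuclideanSpace ℝ (Fin 3))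
    (hdil : ∀ X : EuclideanSpace ℝ (Fin 3), 1 / 2 < X 2 → X 2 < 1 → U X = U ((2 : ℝ) • X))
    (hharm : ∀ X : EuclideanSpace ℝ (Fin 3), 1 < X 2 → X 2 < 2 →
      ∑ i : Fin 3, fderiv ℝ (fun Y => fderiv ℝ U Y (EuclideanSpace.single i (1 : ℝ))) X
        (EuclideanSpace.single i (1 : ℝ)) = 0)
    (X : EuclideanSpace ℝ (Fin 3)) (h1 : 1 / 2 < X 2) (h2 : X 2 < 1) :
    ∑ i : Fin 3, fderiv ℝ (fun Y => fderiv ℝ U Y (EuclideanSpace.single i (1 : ℝ))) X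
      (EuclideanSpace.single i (1 : ℝ)) = 0 := by
  set e : Fin 3 → EuclideanSpace ℝ (Fin 3) := fun i => EuclideanSpace.single i (1 : ℝ) with he
  have hcongr := (noFastBlowDown_weyl_fderiv_congr U (fun Y => U ((2 : ℝ) • Y)) (1 / 2) 1
    hdil X h1 h2).2
  have h2X : 1 < ((2 : ℝ) • X) 2 ∧ ((2 : ℝ) • X) 2 < 2 := by
    constructor <;> simp <;> linarith
  have key : ∀ i, fderiv ℝ (fun Y => fderiv ℝ (fun Z => U ((2 : ℝ) • Z)) Y (e i)) X (e i) =
      (4 : ℝ) • fderiv ℝ (fun Y => fderiv ℝ U Y (e i)) ((2 : ℝ) • X) (e i) := by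
    intro i
    have hfun : (fun Y => fderiv ℝ (fun Z => U ((2 : ℝ) • Z)) Y (e i)) =
        (2 : ℝ) • fun Y => fderiv ℝ U ((2 : ℝ) • Y) (e i) := by
      funext Y
      have h1 : fderiv ℝ (fun Z => U ((2 : ℝ) • Z)) Y = (2 : ℝ) • fderiv ℝ U ((2 : ℝ) • Y) :=
        fderiv_comp_smul (𝕜 := ℝ) (f := U) (x := Y) (2 : ℝ)
      rw [h1]
      rfl
    have h2 : fderiv ℝ (fun Y => fderiv ℝ U ((2 : ℝ) • Y) (e i)) X =
        (2 : ℝ) • fderiv ℝ (fun Z => fderiv ℝ U Z (e i)) ((2 : ℝ) • X) :=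
      fderiv_comp_smul (𝕜 := ℝ) (f := fun Z => fderiv ℝ U Z (e i)) (x := X) (2 : ℝ)
    rw [hfun, fderiv_const_smul_field, Pi.smul_apply, h2, smul_smul, FunLike.coe_smul,
      Pi.smul_apply]
    norm_num
  calc ∑ i : Fin 3, fderiv ℝ (fun Y => fderiv ℝ U Y (e i)) X (e i)
      = ∑ i : Fin 3, fderiv ℝ (fun Y => fderiv ℝ (fun Z => U ((2 : ℝ) • Z)) Y (e i)) X (e i) :=
        Finset.sum_congr rfl fun i _ => by rw [hcongr i]
    _ = (4 : ℝ) • ∑ i : Fin 3, fderiv ℝ (fun Y => fderiv ℝ U Y (e i)) ((2 : ℝ) • X) (e i) := by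
        rw [Finset.smul_sum]
        exact Finset.sum_congr rfl fun i _ => key i
    _ = 0 := by rw [hharm _ h2X.1 h2X.2, smul_zero]

/-- **Harmonicity at the interface plane by continuity.**  For a smooth `U`, if
`Σᵢ ∂ᵢ∂ᵢ U = 0` on the open band `1 < Y₂ < 2` then also at every point of the plane `X₂ = 1`
(the left-hand side is continuous and `X` is a limit of points of the band above it).
[folklore] -/
theorem noFastBlowDown_harmonic_interface
    (U : EuclideanSpace ℝ (Fin 3) → EuclideanSpace ℝ (Fin 3))
    (hU : ContDiff ℝ ((⊤ : ℕ∞) : WithTop ℕ∞) U)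
    (hharm : ∀ X : EuclideanSpace ℝ (Fin 3), 1 < X 2 → X 2 < 2 →
      ∑ i : Fin 3, fderiv ℝ (fun Y => fderiv ℝ U Y (EuclideanSpace.single i (1 : ℝ))) X
        (EuclideanSpace.single i (1 : ℝ)) = 0)
    (X : EuclideanSpace ℝ (Fin 3)) (hX : X 2 = 1) :
    ∑ i : Fin 3, fderiv ℝ (fun Y => fderiv ℝ U Y (EuclideanSpace.single i (1 : ℝ))) X
      (EuclideanSpace.single i (1 : ℝ)) = 0 := by
  set e : Fin 3 → EuclideanSpace ℝ (Fin 3) := fun i => EuclideanSpace.single i (1 : ℝ) with he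
  set S : EuclideanSpace ℝ (Fin 3) → EuclideanSpace ℝ (Fin 3) := fun Y =>
    ∑ i : Fin 3, fderiv ℝ (fun Z => fderiv ℝ U Z (e i)) Y (e i) with hS
  have hSc : Continuous S := by
    refine continuous_finsetSum _ fun i _ => ?_
    exact (noFastBlowDown_weyl_contDiff_fderiv_apply
      (noFastBlowDown_weyl_contDiff_fderiv_apply hU (e i)) (e i)).continuous
  -- along the vertical segment above `X`
  set f : ℝ → EuclideanSpace ℝ (Fin 3) := fun t => S (X + t • e 2) with hf
  have hfc : Continuous f := hSc.comp (by fun_prop)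
  have hf0 : ∀ t : ℝ, 0 < t → t < 1 → f t = 0 := by
    intro t ht0 ht1
    have ht : (X + t • e 2) 2 = 1 + t := by simp [he, hX]
    exact hharm _ (by rw [ht]; linarith) (by rw [ht]; linarith)
  have h1 : Tendsto f (𝓝[>] 0) (𝓝 (f 0)) := hfc.continuousAt.tendsto.mono_left nhdsWithin_le_nhds
  have h2 : f =ᶠ[𝓝[>] 0] fun _ => 0 := by
    filter_upwards [Ioo_mem_nhdsGT one_pos] with t ht using hf0 t ht.1 ht.2
  have h3 : Tendsto f (𝓝[>] 0) (𝓝 0) := (tendsto_congr' h2).2 tendsto_const_nhds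
  have h4 : f 0 = 0 := tendsto_nhds_unique h1 h3
  simpa [hf, hS] using h4

/-! ## The registered tools stub -/

/-- **Pairing and transfer tools (registered stub).** Conjunction of
`noFastBlowDown_laplacian_pairing_eq_zero`, `noFastBlowDown_harmonic_lower_band` and
`noFastBlowDown_harmonic_interface`. [folklore] -/
theorem stub_noFastBlowDownPairingTools :
    (∀ (W V' : EuclideanSpace ℝ (Fin 3) → EuclideanSpace ℝ (Fin 3)) (P Q' : EuclideanSpace ℝ (Fin 3) → ℝ)
      (C C' : ℝ) (φ : EuclideanSpace ℝ (Fin 3) → ℝ) (i : Fin 3),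
      ContDiff ℝ ((⊤ : ℕ∞) : WithTop ℕ∞) W → ContDiff ℝ ((⊤ : ℕ∞) : WithTop ℕ∞) P →
      (∀ X : EuclideanSpace ℝ (Fin 3),
        ∑ i : Fin 3, (fderiv ℝ W X (EuclideanSpace.single i (1 : ℝ))) i = 0) →
      (∀ X : EuclideanSpace ℝ (Fin 3), (fderiv ℝ W X) (W X) + gradient P X =
        ∑ i : Fin 3, fderiv ℝ (fun Y => fderiv ℝ W Y (EuclideanSpace.single i (1 : ℝ))) X
          (EuclideanSpace.single i (1 : ℝ))) →
      (∀ X, ‖W X‖ ≤ C') → Continuous V' → Continuous Q' →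
      ContDiff ℝ ((⊤ : ℕ∞) : WithTop ℕ∞) φ → HasCompactSupport φ →
      (∀ Y ∈ tsupport φ, ‖V' Y‖ ≤ C) →
      (∀ ε : ℝ, 0 < ε → ∀ M : ℕ, ∃ m : ℕ, M ≤ m ∧ ∀ Y ∈ tsupport φ,
        ‖W ((2 : ℝ) ^ m • Y) - V' Y‖ ≤ ε * ((2 : ℝ) ^ m)⁻¹ ∧
          |P ((2 : ℝ) ^ m • Y) - Q' Y| ≤ ε * ((2 : ℝ) ^ m)⁻¹) →
      ∫ Y, Laplacian.laplacian φ Y * (V' Y) i = 0) ∧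
    (∀ (U : EuclideanSpace ℝ (Fin 3) → EuclideanSpace ℝ (Fin 3)),
      (∀ X : EuclideanSpace ℝ (Fin 3), 1 / 2 < X 2 → X 2 < 1 → U X = U ((2 : ℝ) • X)) →
      (∀ X : EuclideanSpace ℝ (Fin 3), 1 < X 2 → X 2 < 2 →
        ∑ i : Fin 3, fderiv ℝ (fun Y => fderiv ℝ U Y (EuclideanSpace.single i (1 : ℝ))) X
          (EuclideanSpace.single i (1 : ℝ)) = 0) →
      ∀ X : EuclideanSpace ℝ (Fin 3), 1 / 2 < X 2 → X 2 < 1 →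
        ∑ i : Fin 3, fderiv ℝ (fun Y => fderiv ℝ U Y (EuclideanSpace.single i (1 : ℝ))) X
          (EuclideanSpace.single i (1 : ℝ)) = 0) ∧
    (∀ (U : EuclideanSpace ℝ (Fin 3) → EuclideanSpace ℝ (Fin 3)),
      ContDiff ℝ ((⊤ : ℕ∞) : WithTop ℕ∞) U →
      (∀ X : EuclideanSpace ℝ (Fin 3), 1 < X 2 → X 2 < 2 →
        ∑ i : Fin 3, fderiv ℝ (fun Y => fderiv ℝ U Y (EuclideanSpace.single i (1 : ℝ))) X
          (EuclideanSpace.single i (1 : ℝ)) = 0) →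
      ∀ X : EuclideanSpace ℝ (Fin 3), X 2 = 1 →
        ∑ i : Fin 3, fderiv ℝ (fun Y => fderiv ℝ U Y (EuclideanSpace.single i (1 : ℝ))) X
          (EuclideanSpace.single i (1 : ℝ)) = 0) :=
  ⟨noFastBlowDown_laplacian_pairing_eq_zero, noFastBlowDown_harmonic_lower_band,
    noFastBlowDown_harmonic_interface⟩

end Summit.AnomalousDissipation.AnomalousDissipation.Theorems

end
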